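import Literature.NumberTheory.EllipticCurves.LatticeIndexTwoHalfPeriodProofs
import Mathlib.NumberTheory.Padics.PadicVal.Basic
import HarnessLib

/-!
# Line `star` on crux E1M (stmt-BirchSwinnertonDyer-20341): preliminaries for THE NODE LAW from the cusp-image fact —
# `℘` of the Vélu superlattice at the other half-periods, and the final `±256` bookkeeping

Lead star-p1 GEN 18.  Two self-contained lemmas used by `Theorems/EisensteinDepletionAtTwoStarOptBSFSigmaNodeCusp.lean`
(`SigmaNode.sigmaNode_of_cuspImageNonsingular`: the node law (N256) at every level from the printed fact «images of the cusps over `∞`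
under an `X₁(N)`-parametrisation reduce into the identity component», CES 2003 §6.1.2 + Igusa/Katz–Mazur 12.6 + ATAEC IV.9.1):

* `weierstrassP_velu_otherHalfPeriod` — for the Vélu superlattice `Λ'' = Λ + ℤz₀` of a half-period `z₀` (invariants `12e₀² + 16B`,
  `−8e₀³ + 32Be₀`, `e₀ = ℘_Λ(z₀)`, `B = 3e₀² − g₂/4`; tree `PeriodPair.lattice_eq_of_velu_invariants`) and a half-period `μ/2` of `Λ` off
  `±z₀ + Λ`: `℘_{Λ''}(μ/2) = −2e₀` — the `℘`-value of the generator of the DUAL kernel on Vélu's curve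
  (`4X³ − g₂''X − g₃'' = 4(X + 2e₀)((X − e₀)² − 4B)`), via the transformation `℘_{Λ''} = (℘_Λ² − e₀℘_Λ + B)/(℘_Λ − e₀)`;
* `int_eq_pm_256` — an integer with no odd prime factor satisfying `βₙ²·D = 256·Δ` with `βₙ, Δ` odd is `±256`.

No `sorry`, no definition, no named fact; nothing here reads `r_an`; E1M / BSD are NOT proved by this file.
-/

set_option linter.dupNamespace false
set_option autoImplicit false

noncomputable section

open scoped Classical PeriodPair
open Polynomial

namespace Summit.BirchSwinnertonDyer.BirchSwinnertonDyer.Theorems.DepletionAtTwo.SigmaNode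
/-! ### Vélu on the analytic side: the value of `℘_{Λ + ℤz₀}` at the other half-periods -/

/-- **`℘_{Λ''}(μ/2) = −2℘_Λ(z₀)`** for the Vélu superlattice `Λ'' ⊇ Λ` of the half-period `z₀` (invariants `12e₀² + 16B`, `−8e₀³ + 32Be₀`,
`e₀ = ℘_Λ(z₀)`, `B = 3e₀² − g₂/4 ≠ 0`) and `μ ∈ Λ` with `μ/2 ∉ Λ`, `μ/2 − z₀ ∉ Λ` (a half-period of `Λ` other than `±z₀`): the transformation
`℘_{Λ''} = (℘_Λ² − e₀℘_Λ + B)/(℘_Λ − e₀)` (`velu_two_transformation_polynomial_identity`) evaluated at `e₁ = ℘_Λ(μ/2)`, a root `≠ e₀` of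
`4X³ − g₂X − g₃`.  (`−2e₀` is the rational 2-torsion `℘`-value of Vélu's curve: `4X³ − g₂''X − g₃'' = 4(X + 2e₀)((X − e₀)² − 4B)`.)
[cite: SilvermanAEC2009, III.4 Example 4.5] [cite: Lawden1989, §9.8] -/
theorem weierstrassP_velu_otherHalfPeriod (L L'' : PeriodPair) {z₀ : ℂ} (hz₀ : z₀ ∉ L.lattice) (h2 : 2 * z₀ ∈ L.lattice)
    {B : ℂ} (hB : B = 3 * ℘[L] z₀ ^ 2 - L.g₂ / 4) (hB0 : B ≠ 0)
    (h₂ : L''.g₂ = 12 * ℘[L] z₀ ^ 2 + 16 * B) (h₃ : L''.g₃ = -8 * ℘[L] z₀ ^ 3 + 32 * B * ℘[L] z₀)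
    {μ : ℂ} (hμ : μ ∈ L.lattice) (hμ2 : μ / 2 ∉ L.lattice) (hμz : μ / 2 - z₀ ∉ L.lattice) :
    ℘[L''] (μ / 2) = -2 * ℘[L] z₀ := by
  set x₀ := ℘[L] z₀ with hx₀
  set P : ℂ[X] := X ^ 2 - C x₀ * X + C B with hP
  set Q : ℂ[X] := X - C x₀ with hQ
  have hQ0 : Q ≠ 0 := X_sub_C_ne_zero x₀
  have hQdeg : Q.natDegree = 1 := natDegree_X_sub_C x₀
  have hPdeg : P.natDegree = 2 := by rw [hP]; compute_degree!
  have hnc : ∀ k : ℂ, P ≠ C k * Q := by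
    intro k hk
    have h := congrArg natDegree hk
    rw [hPdeg] at h
    by_cases hk0 : k = 0
    · rw [hk0, map_zero, zero_mul, natDegree_zero] at h; exact absurd h (by norm_num)
    · rw [natDegree_C_mul hk0, hQdeg] at h; exact absurd h (by norm_num)
  have hcubic₀ : 4 * x₀ ^ 3 - L.g₂ * x₀ - L.g₃ = 0 := by
    rw [hx₀, ← L.derivWeierstrassP_sq z₀ hz₀, L.derivWeierstrassP_eq_zero_of_two_mul_mem h2]; ring
  have hid : (derivative P * Q - P * derivative Q) ^ 2 * (4 * X ^ 3 - C L.g₂ * X - C L.g₃) =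
      Q * (4 * P ^ 3 - C L''.g₂ * P * Q ^ 2 - C L''.g₃ * Q ^ 3) :=
    PeriodPair.velu_two_transformation_polynomial_identity hcubic₀ hB h₂ h₃
  obtain ⟨hle, hz₀mem, hidx⟩ := L.lattice_eq_of_velu_invariants hz₀ h2 hB hB0 L'' h₂ h₃
  obtain ⟨ε, hε, c, hc⟩ := L.exists_eq_weierstrassP_comp_of_transformation_polynomial_identity L'' hQ0 hnc hid
  have hcmem : c ∈ L''.lattice :=
    L.const_mem_lattice_of_eq_weierstrassP_comp L'' hQ0 (by rw [hQdeg, hPdeg]; norm_num) hc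
  -- `μ/2 ∉ Λ''`, `℘_Λ(μ/2) ≠ e₀`
  have hμ'' : μ / 2 ∉ L''.lattice := by
    intro h
    rcases hidx _ h with h' | h'
    · exact hμ2 h'
    · exact hμz h'
  have hne : ℘[L] (μ / 2) ≠ x₀ := by
    intro h
    rcases (L.weierstrassP_eq_weierstrassP_iff hμ2 hz₀).mp h with h' | h'
    · apply hμz
      have e : μ / 2 - z₀ = (μ / 2 + z₀) - 2 * z₀ := by ring
      rw [e]; exact sub_mem h' h2
    · exact hμz h'
  have hQne : Q.eval (℘[L] (μ / 2)) ≠ 0 := by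
    simpa [hQ, sub_eq_zero] using hne
  have hεc : ε * (μ / 2) + c ∉ L''.lattice := by
    intro h
    apply hμ''
    have h1 : ε * (μ / 2) ∈ L''.lattice := by
      have := sub_mem h hcmem
      rwa [add_sub_cancel_right] at this
    rcases hε with rfl | rfl
    · rwa [one_mul] at h1
    · rw [neg_one_mul] at h1; simpa using neg_mem h1
  have h℘'' : ℘[L''] (ε * (μ / 2) + c) = ℘[L''] (μ / 2) := by
    rw [L''.weierstrassP_add_coe (ε * (μ / 2)) ⟨c, hcmem⟩]
    rcases hε with rfl | rfl
    · rw [one_mul]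
    · rw [neg_one_mul, L''.weierstrassP_neg]
  have hval := hc (μ / 2) hμ2 hQne hεc
  rw [h℘''] at hval
  -- `e₁ = ℘_Λ(μ/2)` is a root of the cubic
  set e₁ := ℘[L] (μ / 2) with he₁
  have hcubic₁ : 4 * e₁ ^ 3 - L.g₂ * e₁ - L.g₃ = 0 := by
    have h2μ : 2 * (μ / 2) ∈ L.lattice := by
      have e : 2 * (μ / 2) = μ := by ring
      rw [e]; exact hμ
    rw [he₁, ← L.derivWeierstrassP_sq (μ / 2) hμ2, L.derivWeierstrassP_eq_zero_of_two_mul_mem h2μ]; ring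
  have hPe : P.eval e₁ = e₁ ^ 2 - x₀ * e₁ + B := by simp [hP]
  have hQe : Q.eval e₁ = e₁ - x₀ := by simp [hQ]
  rw [hPe, hQe] at hval
  have hne' : e₁ - x₀ ≠ 0 := sub_ne_zero.mpr hne
  -- `g₂ = 4(e₁² + e₁e₀ + e₀²)` from the two cubic relations, then the value is `−2e₀`
  have hg₂ : L.g₂ = 4 * (e₁ ^ 2 + e₁ * x₀ + x₀ ^ 2) := by
    have h : (e₁ - x₀) * (4 * (e₁ ^ 2 + e₁ * x₀ + x₀ ^ 2) - L.g₂) = 0 := by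
      linear_combination hcubic₁ - hcubic₀
    have := (mul_eq_zero.mp h).resolve_left hne'
    linear_combination -this
  rw [← hval, div_eq_iff hne', hB, hg₂]
  ring

/-! ### The final integer bookkeeping -/

/-- **An integer `D` with no odd prime factor and `βₙ²·D = 256·Δ`, `βₙ, Δ` odd, is `±256`.** [folklore] -/
theorem int_eq_pm_256 {D βn Δz : ℤ} (hβ : Odd βn) (hΔ : Odd Δz) (hrel : βn ^ 2 * D = 256 * Δz)
    (hodd : ∀ p : ℕ, p.Prime → p ≠ 2 → ¬ (p : ℤ) ∣ D) : D = 256 ∨ D = -256 := by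
  have hD0 : D ≠ 0 := by
    rintro rfl
    have : (256 : ℤ) * Δz = 0 := by rw [← hrel]; ring
    rcases hΔ with ⟨m, hm⟩
    omega
  -- `|D|` is a power of two
  obtain ⟨j, hj⟩ : ∃ j : ℕ, D.natAbs = 2 ^ j := by
    rcases Nat.eq_two_pow_or_exists_odd_prime_and_dvd D.natAbs with h | ⟨p, hp, hpd, hpodd⟩
    · exact h
    · exfalso
      have hp2 : p ≠ 2 := by rintro rfl; exact absurd hpodd (by decide)
      exact hodd p hp hp2 (Int.natCast_dvd.mpr hpd)
  -- compare 2-adic valuations in `βₙ²·D = 256·Δ`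
  have hnat : βn.natAbs ^ 2 * 2 ^ j = 2 ^ 8 * Δz.natAbs := by
    have h := congrArg Int.natAbs hrel
    rw [Int.natAbs_mul, Int.natAbs_mul, Int.natAbs_pow, hj] at h
    simpa using h
  have hβodd : Odd βn.natAbs := Int.natAbs_odd.mpr hβ
  have hΔodd : Odd Δz.natAbs := Int.natAbs_odd.mpr hΔ
  have hj8 : j = 8 := by
    have h1 : (βn.natAbs ^ 2 * 2 ^ j).factorization 2 = j := by
      rw [Nat.factorization_mul (pow_ne_zero _ (by rintro h0; rw [h0] at hβodd; exact absurd hβodd (by decide)))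
        (pow_ne_zero _ two_ne_zero), Nat.factorization_pow, Nat.factorization_pow]
      simp only [Finsupp.coe_add, Finsupp.coe_smul, Pi.add_apply, Pi.smul_apply, smul_eq_mul,
        Nat.Prime.factorization_self Nat.prime_two]
      rw [Nat.factorization_eq_zero_of_not_dvd (fun h ↦ (Nat.not_even_iff_odd.mpr hβodd) (even_iff_two_dvd.mpr h))]
      ring
    have h2 : (2 ^ 8 * Δz.natAbs).factorization 2 = 8 := by
      rw [Nat.factorization_mul (pow_ne_zero _ two_ne_zero)
        (by rintro h0; rw [h0] at hΔodd; exact absurd hΔodd (by decide)), Nat.factorization_pow]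
      simp only [Finsupp.coe_add, Finsupp.coe_smul, Pi.add_apply, Pi.smul_apply, smul_eq_mul,
        Nat.Prime.factorization_self Nat.prime_two]
      rw [Nat.factorization_eq_zero_of_not_dvd (fun h ↦ (Nat.not_even_iff_odd.mpr hΔodd) (even_iff_two_dvd.mpr h))]
    have key : (βn.natAbs ^ 2 * 2 ^ j).factorization 2 = (2 ^ 8 * Δz.natAbs).factorization 2 := by rw [hnat]
    rw [h1, h2] at key
    exact key
  rw [hj8] at hj
  have h256 : D.natAbs = (256 : ℤ).natAbs := by rw [hj]; norm_num
  rcases Int.natAbs_eq_natAbs_iff.mp h256 with h | h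
  · exact Or.inl h
  · exact Or.inr h

end Summit.BirchSwinnertonDyer.BirchSwinnertonDyer.Theorems.DepletionAtTwo.SigmaNode

end
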